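import Summits.AtomisticToContinuum.Crystallization.Theorems.NashClassCertificatesNashTwoShellGapForceBalance

/-!
# Crux `NashTwoShellGap` (stmt-AtomisticToContinuum-16826), line `birth`: Nash ⇒ site stability

The second-order companion of `Theorems.NashTwoShellGapForceBalance.stub_nashForceBalance`: what
the Nash (best-response) hypothesis of the crux hands to the certificate tier beyond force balance.
For a `1/3`-separated Nash Lennard-Jones configuration `x : Fin N → ℝ³` and a particle `i`, write
`d_j = x_i − x_j`, `r_j = |d_j|` (`j ≠ i`), `V(‖w‖) = W(‖w‖²)` with `W(s) = s⁻⁶/12 − s⁻³/6`.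

* `stub_nashSiteStability` — the on-site Hessian `H_i = ∑_{j ≠ i} ∇²V(x_i − x_j)` is positive
  semidefinite: for every direction `v`,
  `0 ≤ ∑_{j ≠ i} [(r_j⁻⁸ − r_j⁻¹⁴)‖v‖² + (14 r_j⁻¹⁶ − 8 r_j⁻¹⁰)⟪d_j, v⟫²]`,
  the right-hand side being `d²/dt² ∑_{j ≠ i} V(‖d_j + t v‖)` at `t = 0`.  Proof: the relocation
  energy `g(t) = ∑_{j ≠ i} V(|x_i + t v − x_j|)` has a local minimum at `t = 0` (nearby points are
  free by separation, and Nash compares); it is differentiable near `0` (chain rule through `W`),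
  and its derivative is differentiable at `0` with the displayed derivative; were that negative,
  Mathlib's second-derivative test would make `0` a local maximum too, so `g` would be locally
  constant and `deriv (deriv g) 0 = 0` — a contradiction.
* `stub_nashLaplacianCut` — its trace: `0 ≤ ∑_{j ≠ i} (11 r_j⁻¹⁴ − 5 r_j⁻⁸)` (sum the previous
  inequality over the standard orthonormal basis, `∑_k ⟪d, e_k⟫² = ‖d‖²`).
* `stub_nashNearNeighbour` — hence, if `N ≥ 2`, some `j ≠ i` has `5 r_j⁶ ≤ 11` (otherwise every
  term `11 r⁻¹⁴ − 5 r⁻⁸ = r⁻⁸(11 r⁻⁶ − 5)` of the nonempty sum is negative).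

No definitions; `[folklore]` calculus.
-/

noncomputable section

namespace Summit.AtomisticToContinuum.Crystallization.Theorems.NashTwoShellGapSiteStability

open scoped BigOperators Classical RealInnerProductSpace Topology
open Filter
open Literature.MathematicalPhysics.StatisticalMechanics
open Summit.AtomisticToContinuum.Crystallization.Theorems.NashTwoShellGapForceBalance

/-- The derivative `W′(s) = −(1/2) s⁻⁷ + (1/2) s⁻⁴` of the radial profile has derivative
`W″(s) = (7/2) s⁻⁸ − 2 s⁻⁵` at every `s ≠ 0`. [folklore] -/
theorem hasDerivAt_profileDeriv {s : ℝ} (hs : s ≠ 0) :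
    HasDerivAt (fun u : ℝ => -(1 / 2) * (u⁻¹) ^ 7 + (1 / 2) * (u⁻¹) ^ 4)
      ((7 / 2) * (s⁻¹) ^ 8 - 2 * (s⁻¹) ^ 5) s := by
  have h1 : HasDerivAt (fun u : ℝ => u⁻¹) (-(s ^ 2)⁻¹) s := hasDerivAt_inv hs
  have h7 := (h1.fun_pow 7).const_mul (-(1 / 2) : ℝ)
  have h4 := (h1.fun_pow 4).const_mul (1 / 2 : ℝ)
  have h := h7.fun_add h4
  refine h.congr_deriv ?_
  rw [← inv_pow s 2]
  push_cast
  ring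

/-- The squared distance along a line, `‖d + t v‖² = ‖d‖² + 2t⟪d, v⟫ + t²‖v‖²`, has derivative
`2⟪d, v⟫ + 2t‖v‖²` at every parameter `t`. [folklore] -/
theorem hasDerivAt_normLineSq (d v : EuclideanSpace ℝ (Fin 3)) (t : ℝ) :
    HasDerivAt (fun t : ℝ => ‖d + t • v‖ ^ 2) (2 * ⟪d, v⟫ + 2 * t * ‖v‖ ^ 2) t := by
  have h1 : HasDerivAt (fun t : ℝ => ‖d‖ ^ 2 + 2 * t * ⟪d, v⟫ + t ^ 2 * ‖v‖ ^ 2)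
      (0 + 2 * 1 * ⟪d, v⟫ + ((2 : ℕ) * (id t) ^ (2 - 1) * 1) * ‖v‖ ^ 2) t := by
    refine ((hasDerivAt_const _ _).fun_add ?_).fun_add ?_
    · exact ((hasDerivAt_id t).const_mul 2).mul_const _
    · exact ((hasDerivAt_id t).fun_pow 2).mul_const _
  have h2 : (fun t : ℝ => ‖d + t • v‖ ^ 2) =
      fun t : ℝ => ‖d‖ ^ 2 + 2 * t * ⟪d, v⟫ + t ^ 2 * ‖v‖ ^ 2 :=
    funext fun t => norm_add_smul_sq d v t
  rw [h2]
  refine h1.congr_deriv ?_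
  simp only [id]
  push_cast
  ring

/-- **First derivative of one pair term along a relocation line, at a general parameter.**
For `d + t v ≠ 0`, `t ↦ V_LJ(‖d + t v‖) = W(‖d + t v‖²)` has derivative
`W′(‖d + t v‖²) · (2⟪d, v⟫ + 2t‖v‖²)` at `t`. [folklore] -/
theorem hasDerivAt_pairLine (d v : EuclideanSpace ℝ (Fin 3)) (t : ℝ) (h : d + t • v ≠ 0) :
    HasDerivAt (fun t : ℝ => lennardJones ‖d + t • v‖)
      ((-(1 / 2) * ((‖d + t • v‖ ^ 2)⁻¹) ^ 7 + (1 / 2) * ((‖d + t • v‖ ^ 2)⁻¹) ^ 4) *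
        (2 * ⟪d, v⟫ + 2 * t * ‖v‖ ^ 2)) t := by
  have hq : ‖d + t • v‖ ^ 2 ≠ 0 := pow_ne_zero 2 (norm_ne_zero_iff.2 h)
  have hW : HasDerivAt (fun u : ℝ => (1 / 12) * (u⁻¹) ^ 6 - (1 / 6) * (u⁻¹) ^ 3)
      (-(1 / 2) * (((fun s : ℝ => ‖d + s • v‖ ^ 2) t)⁻¹) ^ 7 +
        (1 / 2) * (((fun s : ℝ => ‖d + s • v‖ ^ 2) t)⁻¹) ^ 4)
      ((fun s : ℝ => ‖d + s • v‖ ^ 2) t) := hasDerivAt_profile hq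
  have hc := hW.comp t (hasDerivAt_normLineSq d v t)
  have hfun : (fun t : ℝ => lennardJones ‖d + t • v‖) =
      (fun u : ℝ => (1 / 12) * (u⁻¹) ^ 6 - (1 / 6) * (u⁻¹) ^ 3) ∘
        fun s : ℝ => ‖d + s • v‖ ^ 2 := by
    funext s
    simp only [Function.comp, lennardJones_norm_eq]
  rw [hfun]
  exact hc

/-- **Second derivative of one pair term at the base point.** For `d ≠ 0`, the first derivative
`t ↦ W′(‖d + t v‖²) · (2⟪d, v⟫ + 2t‖v‖²)` has derivative
`(‖d‖⁻⁸ − ‖d‖⁻¹⁴)‖v‖² + (14‖d‖⁻¹⁶ − 8‖d‖⁻¹⁰)⟪d, v⟫²` at `t = 0`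
(`= vᵀ ∇²V(d) v`, `∇²V(d) = (V′(r)/r)(I − d dᵀ/r²) + V″(r) d dᵀ/r²`, `r = ‖d‖`). [folklore] -/
theorem hasDerivAt_pairLineDeriv (d v : EuclideanSpace ℝ (Fin 3)) (hd : d ≠ 0) :
    HasDerivAt (fun t : ℝ =>
      (-(1 / 2) * ((‖d + t • v‖ ^ 2)⁻¹) ^ 7 + (1 / 2) * ((‖d + t • v‖ ^ 2)⁻¹) ^ 4) *
        (2 * ⟪d, v⟫ + 2 * t * ‖v‖ ^ 2))
      (((‖d‖⁻¹) ^ 8 - (‖d‖⁻¹) ^ 14) * ‖v‖ ^ 2 +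
        (14 * (‖d‖⁻¹) ^ 16 - 8 * (‖d‖⁻¹) ^ 10) * ⟪d, v⟫ ^ 2) 0 := by
  have hd1 : ‖d‖ ≠ 0 := norm_ne_zero_iff.2 hd
  have hd2 : ‖d‖ ^ 2 ≠ 0 := pow_ne_zero 2 hd1
  have h0 : (fun t : ℝ => ‖d + t • v‖ ^ 2) 0 = ‖d‖ ^ 2 := by simp
  -- first factor: `W′ ∘ (t ↦ ‖d + t v‖²)`
  have hW' : HasDerivAt (fun u : ℝ => -(1 / 2) * (u⁻¹) ^ 7 + (1 / 2) * (u⁻¹) ^ 4)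
      ((7 / 2) * ((‖d‖ ^ 2)⁻¹) ^ 8 - 2 * ((‖d‖ ^ 2)⁻¹) ^ 5)
      ((fun t : ℝ => ‖d + t • v‖ ^ 2) 0) := by
    rw [h0]
    exact hasDerivAt_profileDeriv hd2
  have hA := hW'.comp 0 (hasDerivAt_norm_add_smul_sq d v)
  -- second factor: the affine function `2⟪d, v⟫ + 2t‖v‖²`
  have hB : HasDerivAt (fun t : ℝ => 2 * ⟪d, v⟫ + 2 * t * ‖v‖ ^ 2) (0 + 2 * 1 * ‖v‖ ^ 2) 0 :=
    (hasDerivAt_const _ _).fun_add (((hasDerivAt_id (0 : ℝ)).const_mul 2).mul_const _)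
  have hAB := hA.fun_mul hB
  have hfun : (fun t : ℝ =>
      (-(1 / 2) * ((‖d + t • v‖ ^ 2)⁻¹) ^ 7 + (1 / 2) * ((‖d + t • v‖ ^ 2)⁻¹) ^ 4) *
        (2 * ⟪d, v⟫ + 2 * t * ‖v‖ ^ 2)) = fun t : ℝ =>
      ((fun u : ℝ => -(1 / 2) * (u⁻¹) ^ 7 + (1 / 2) * (u⁻¹) ^ 4) ∘
          fun t : ℝ => ‖d + t • v‖ ^ 2) t * (2 * ⟪d, v⟫ + 2 * t * ‖v‖ ^ 2) := by
    funext t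
    simp only [Function.comp]
  rw [hfun]
  refine hAB.congr_deriv ?_
  simp only [Function.comp, zero_smul, add_zero, mul_zero, zero_add, mul_one]
  field_simp
  ring

/-- **Second-order necessary condition for a local minimum on a line.** If `g : ℝ → ℝ` has a local
minimum at `0`, is differentiable near `0` with derivative `g′`, and `g′` has derivative `G` at
`0`, then `0 ≤ G`.  (Were `G < 0`, Mathlib's second-derivative test `isLocalMax_of_deriv_deriv_neg`
would make `0` a local maximum as well, so `g` would be constant near `0`, forcing
`deriv (deriv g) 0 = 0 ≠ G`.) [folklore] -/
theorem secondOrder_nonneg_of_isLocalMin {g g' : ℝ → ℝ} {G : ℝ} (hmin : IsLocalMin g 0)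
    (hder : ∀ᶠ t in 𝓝 (0 : ℝ), HasDerivAt g (g' t) t) (hder2 : HasDerivAt g' G 0) : 0 ≤ G := by
  refine not_lt.mp fun hneg => ?_
  have hd1 : deriv g =ᶠ[𝓝 (0 : ℝ)] g' := hder.mono fun t ht => ht.deriv
  have hdd : HasDerivAt (deriv g) G 0 := hder2.congr_of_eventuallyEq hd1
  have hcont : ContinuousAt g 0 := hder.self_of_nhds.continuousAt
  have hmax : IsLocalMax g 0 :=
    isLocalMax_of_deriv_deriv_neg (by rw [hdd.deriv]; exact hneg) hmin.deriv_eq_zero hcont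
  have hconst : ∀ᶠ t in 𝓝 (0 : ℝ), g t = g 0 :=
    (Filter.Eventually.and hmin hmax).mono fun t ht => le_antisymm ht.2 ht.1
  have hderiv0 : ∀ᶠ t in 𝓝 (0 : ℝ), deriv g t = 0 := by
    refine hconst.eventually_nhds.mono fun t ht => ?_
    have h1 : g =ᶠ[𝓝 t] fun _ => g 0 := ht
    rw [h1.deriv_eq, deriv_const]
  have hzero : deriv (deriv g) 0 = 0 := by
    have h1 : deriv g =ᶠ[𝓝 (0 : ℝ)] fun _ => (0 : ℝ) := hderiv0
    rw [h1.deriv_eq, deriv_const]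
  rw [hdd.deriv] at hzero
  linarith

/-- **Registered sub-goal `stub_nashSiteStability`** (line `birth`): the on-site Hessian of a
`1/3`-separated Nash Lennard-Jones configuration is positive semidefinite — for every particle `i`
and direction `v`,
`0 ≤ ∑_{j ≠ i} [(r_ij⁻⁸ − r_ij⁻¹⁴)‖v‖² + (14 r_ij⁻¹⁶ − 8 r_ij⁻¹⁰)⟪x_i − x_j, v⟫²] = vᵀ H_i v`,
`H_i = ∑_{j ≠ i} ∇²V(x_i − x_j)`.  Second-order necessary condition for the relocation energy
`t ↦ ∑_{j ≠ i} V(|x_i + t v − x_j|)`, which the Nash hypothesis makes locally minimal at `t = 0`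
(points near `x_i` are free by separation). [folklore] -/
theorem stub_nashSiteStability : ∀ (N : ℕ) (x : Fin N → EuclideanSpace ℝ (Fin 3)), (∀ i j : Fin N, i ≠ j → 1 / 3 ≤ dist (x i) (x j)) → (∀ (i : Fin N) (y : EuclideanSpace ℝ (Fin 3)), (∀ j : Fin N, j ≠ i → y ≠ x j) → Literature.MathematicalPhysics.StatisticalMechanics.siteEnergy Literature.MathematicalPhysics.StatisticalMechanics.lennardJones x i ≤ ∑ j ∈ Finset.univ.erase i, Literature.MathematicalPhysics.StatisticalMechanics.lennardJones (dist y (x j))) → ∀ (i : Fin N) (v : EuclideanSpace ℝ (Fin 3)), 0 ≤ ∑ j ∈ Finset.univ.erase i, (((dist (x i) (x j))⁻¹ ^ 8 - (dist (x i) (x j))⁻¹ ^ 14) * ‖v‖ ^ 2 + (14 * (dist (x i) (x j))⁻¹ ^ 16 - 8 * (dist (x i) (x j))⁻¹ ^ 10) * (inner ℝ (x i - x j) v) ^ 2) := by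
  intro N x hsep hnash i v
  simp only [dist_eq_norm]
  -- the pair vectors are nonzero by separation
  have hd : ∀ j ∈ Finset.univ.erase i, x i - x j ≠ 0 := by
    intro j hj h0
    have h13 := hsep i j (Finset.ne_of_mem_erase hj).symm
    rw [dist_eq_norm, h0, norm_zero] at h13
    norm_num at h13
  -- a parameter window in which the relocated particle stays free
  have hε : (0 : ℝ) < 1 / (3 * (‖v‖ + 1)) := by positivity
  have hfree : ∀ t : ℝ, |t| < 1 / (3 * (‖v‖ + 1)) → ∀ j : Fin N, j ≠ i → x i + t • v ≠ x j := by
    intro t ht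
    have htv : ‖t • v‖ < 1 / 3 := by
      rw [norm_smul, Real.norm_eq_abs]
      have hv0 : 0 ≤ ‖v‖ := norm_nonneg v
      have hv1 : 0 < ‖v‖ + 1 := by positivity
      calc |t| * ‖v‖ ≤ 1 / (3 * (‖v‖ + 1)) * ‖v‖ := mul_le_mul_of_nonneg_right ht.le hv0
        _ < 1 / (3 * (‖v‖ + 1)) * (‖v‖ + 1) := mul_lt_mul_of_pos_left (by linarith) hε
        _ = 1 / 3 := by field_simp
    intro j hji h0
    have h13 := hsep i j hji.symm
    have hdj : dist (x i) (x j) = ‖t • v‖ := by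
      rw [← h0, dist_eq_norm, sub_add_cancel_left, norm_neg]
    linarith
  -- the relocation energy along the line and its derivative near `0`
  set g : ℝ → ℝ := fun t => ∑ j ∈ Finset.univ.erase i, lennardJones (dist (x i + t • v) (x j))
    with hg
  have hg_eq : g = fun t => ∑ j ∈ Finset.univ.erase i, lennardJones ‖x i - x j + t • v‖ := by
    funext t
    simp only [hg, dist_eq_norm, add_sub_right_comm]
  set g' : ℝ → ℝ := fun t => ∑ j ∈ Finset.univ.erase i,
      (-(1 / 2) * ((‖x i - x j + t • v‖ ^ 2)⁻¹) ^ 7 + (1 / 2) * ((‖x i - x j + t • v‖ ^ 2)⁻¹) ^ 4) *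
        (2 * ⟪x i - x j, v⟫ + 2 * t * ‖v‖ ^ 2)
  -- (1) local minimality at `0` from the Nash hypothesis
  have hmin : IsLocalMin g 0 := by
    refine Filter.Eventually.mono (Metric.ball_mem_nhds (0 : ℝ) hε) fun t ht => ?_
    replace ht : |t| < 1 / (3 * (‖v‖ + 1)) := by simpa [Real.dist_eq] using ht
    have h := hnash i (x i + t • v) (hfree t ht)
    have hg0 : g 0 = siteEnergy lennardJones x i := by
      simp only [hg, zero_smul, add_zero, siteEnergy]
    rw [hg0]
    exact h
  -- (2) differentiability near `0`
  have hder : ∀ᶠ t in 𝓝 (0 : ℝ), HasDerivAt g (g' t) t := by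
    refine Filter.Eventually.mono (Metric.ball_mem_nhds (0 : ℝ) hε) fun t ht => ?_
    replace ht : |t| < 1 / (3 * (‖v‖ + 1)) := by simpa [Real.dist_eq] using ht
    rw [hg_eq]
    apply HasDerivAt.fun_sum
    intro j hj
    have hne : x i - x j + t • v ≠ 0 := by
      have h1 := sub_ne_zero.2 (hfree t ht j (Finset.ne_of_mem_erase hj))
      rwa [add_sub_right_comm] at h1
    exact hasDerivAt_pairLine (x i - x j) v t hne
  -- (3) the second derivative at `0`
  have hder2 : HasDerivAt g' (∑ j ∈ Finset.univ.erase i,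
      (((‖x i - x j‖⁻¹) ^ 8 - (‖x i - x j‖⁻¹) ^ 14) * ‖v‖ ^ 2 +
        (14 * (‖x i - x j‖⁻¹) ^ 16 - 8 * (‖x i - x j‖⁻¹) ^ 10) * ⟪x i - x j, v⟫ ^ 2)) 0 := by
    apply HasDerivAt.fun_sum
    intro j hj
    exact hasDerivAt_pairLineDeriv (x i - x j) v (hd j hj)
  -- (4) second-order necessary condition
  exact secondOrder_nonneg_of_isLocalMin hmin hder hder2

/-- **Registered sub-goal `stub_nashLaplacianCut`** (line `birth`): the trace of site stability,
`0 ≤ tr H_i = ∑_{j ≠ i} ΔV(x_i − x_j) = ∑_{j ≠ i} (11 r_ij⁻¹⁴ − 5 r_ij⁻⁸)`: sum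
`stub_nashSiteStability` over the standard orthonormal basis `e_0, e_1, e_2` of `ℝ³`
(`‖e_k‖ = 1`, `∑_k ⟪d, e_k⟫² = ‖d‖² = r²`, `3(r⁻⁸ − r⁻¹⁴) + (14 r⁻¹⁶ − 8 r⁻¹⁰) r² = 11 r⁻¹⁴ − 5 r⁻⁸`).
[folklore] -/
theorem stub_nashLaplacianCut : ∀ (N : ℕ) (x : Fin N → EuclideanSpace ℝ (Fin 3)), (∀ i j : Fin N, i ≠ j → 1 / 3 ≤ dist (x i) (x j)) → (∀ (i : Fin N) (y : EuclideanSpace ℝ (Fin 3)), (∀ j : Fin N, j ≠ i → y ≠ x j) → Literature.MathematicalPhysics.StatisticalMechanics.siteEnergy Literature.MathematicalPhysics.StatisticalMechanics.lennardJones x i ≤ ∑ j ∈ Finset.univ.erase i, Literature.MathematicalPhysics.StatisticalMechanics.lennardJones (dist y (x j))) → ∀ i : Fin N, 0 ≤ ∑ j ∈ Finset.univ.erase i, (11 * (dist (x i) (x j))⁻¹ ^ 14 - 5 * (dist (x i) (x j))⁻¹ ^ 8) := by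
  intro N x hsep hnash i
  set b := EuclideanSpace.basisFun (Fin 3) ℝ
  have h := fun k : Fin 3 => stub_nashSiteStability N x hsep hnash i (b k)
  have hsum := Finset.sum_nonneg fun k (_ : k ∈ (Finset.univ : Finset (Fin 3))) => h k
  rw [Finset.sum_comm] at hsum
  refine hsum.trans_eq (Finset.sum_congr rfl fun j hj => ?_)
  have hr : dist (x i) (x j) ≠ 0 := by
    have h13 := hsep i j (Finset.ne_of_mem_erase hj).symm
    intro h0
    rw [h0] at h13
    norm_num at h13
  simp only [b.norm_eq_one, one_pow, mul_one]
  rw [Finset.sum_add_distrib, Finset.sum_const, Finset.card_univ, Fintype.card_fin,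
    ← Finset.mul_sum, b.sum_sq_inner_left, ← dist_eq_norm]
  simp only [nsmul_eq_mul, Nat.cast_ofNat]
  field_simp
  ring

/-- **Registered sub-goal `stub_nashNearNeighbour`** (line `birth`): in a `1/3`-separated Nash
Lennard-Jones configuration of `N ≥ 2` particles, every particle has a neighbour within distance
`(11/5)^{1/6}`: some `j ≠ i` with `5 r_ij⁶ ≤ 11`.  Otherwise every term of the Laplacian cut
`∑_{j ≠ i} (11 r⁻¹⁴ − 5 r⁻⁸)`, `11 r⁻¹⁴ − 5 r⁻⁸ = r⁻⁸ (11 r⁻⁶ − 5)`, would be negative, and the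
sum over the nonempty `univ.erase i` would contradict `stub_nashLaplacianCut`. [folklore] -/
theorem stub_nashNearNeighbour : ∀ (N : ℕ) (x : Fin N → EuclideanSpace ℝ (Fin 3)), (∀ i j : Fin N, i ≠ j → 1 / 3 ≤ dist (x i) (x j)) → (∀ (i : Fin N) (y : EuclideanSpace ℝ (Fin 3)), (∀ j : Fin N, j ≠ i → y ≠ x j) → Literature.MathematicalPhysics.StatisticalMechanics.siteEnergy Literature.MathematicalPhysics.StatisticalMechanics.lennardJones x i ≤ ∑ j ∈ Finset.univ.erase i, Literature.MathematicalPhysics.StatisticalMechanics.lennardJones (dist y (x j))) → ∀ i : Fin N, 2 ≤ N → ∃ j : Fin N, j ≠ i ∧ 5 * (dist (x i) (x j)) ^ 6 ≤ 11 := by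
  intro N x hsep hnash i hN
  by_contra hcon
  push Not at hcon
  have hcut := stub_nashLaplacianCut N x hsep hnash i
  have hne : (Finset.univ.erase i).Nonempty := by
    haveI : Nontrivial (Fin N) := Fin.nontrivial_iff_two_le.2 hN
    obtain ⟨j, hj⟩ := exists_ne i
    exact ⟨j, Finset.mem_erase.2 ⟨hj, Finset.mem_univ j⟩⟩
  have hlt : ∑ j ∈ Finset.univ.erase i,
      (11 * (dist (x i) (x j))⁻¹ ^ 14 - 5 * (dist (x i) (x j))⁻¹ ^ 8) <
      ∑ j ∈ Finset.univ.erase i, (0 : ℝ) := by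
    refine Finset.sum_lt_sum_of_nonempty hne fun j hj => ?_
    have hji : j ≠ i := Finset.ne_of_mem_erase hj
    have hr : 0 < dist (x i) (x j) := lt_of_lt_of_le (by norm_num) (hsep i j hji.symm)
    have h6 : 11 * (dist (x i) (x j))⁻¹ ^ 6 < 5 := by
      rw [inv_pow, ← div_eq_mul_inv, div_lt_iff₀ (pow_pos hr 6)]
      linarith [hcon j hji]
    have hfac : 11 * (dist (x i) (x j))⁻¹ ^ 14 - 5 * (dist (x i) (x j))⁻¹ ^ 8 =
        (dist (x i) (x j))⁻¹ ^ 8 * (11 * (dist (x i) (x j))⁻¹ ^ 6 - 5) := by ring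
    rw [hfac]
    exact mul_neg_of_pos_of_neg (pow_pos (inv_pos.2 hr) 8) (by linarith)
  rw [Finset.sum_const_zero] at hlt
  linarith

end Summit.AtomisticToContinuum.Crystallization.Theorems.NashTwoShellGapSiteStability

end
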